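import Mathlib
import Literature.NumberTheory.Sieve.Maynard2016Lemma7SingFactor
import Literature.NumberTheory.Sieve.Maynard2016Lemma7Reduction
import Literature.NumberTheory.Sieve.Maynard2016Lemma6Split
import Literature.NumberTheory.Sieve.Maynard2016CubeEstimate
import Literature.NumberTheory.Sieve.Maynard2016TupleArith
import HarnessLib

/-!
# Maynard (2016), Lemma 7: the normalisation `M_{m,q}⁻¹`, uniformly in `q` ((6.23)–(6.25))

Topic `Literature/NumberTheory/Sieve`; trunk AntSieve / parity (Maynard 2016 large-gaps ladder, named
fact `Literature.NumberTheory.Sieve.Maynard2016.Lemma7Tuple` of `Maynard2016Lemma7PerTuple.lean`).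

J. Maynard, *Large gaps between primes*, Ann. of Math. (2) 183 (2016), 915–933 = arXiv:1408.5110,
§6, proof of Lemma 7, displays (6.23)–(6.25): the weight `α_{m,q} ≈ M_{m,q}⁻¹` depends on `q` only
through `𝔖_{m,q}`, and "`𝔖_{m,q}⁻¹ = (1 + O(…)) 𝔖_m⁻¹ ∏_p (1 + O_k(p⁻¹))` where the product is over
primes `w < p ≤ y` dividing one of the `m q (h_j − h_i) − 1`".

PROVED here (no named facts), with `M_{m,q} = normMain` (`Maynard2016Lemma7Reduction`),
`𝔖_{m,q} = (classCount/P_w) · singSmall · singLarge_q` (`Maynard2016Lemma6Split`) and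
`singLarge_q⁻¹ = R_q/(Π_m V_q)`, `|R_q − 1| ≤ e^{24k²/(w+1)} − 1`, `V_q⁻¹ ≥ 1 − Σ_p #M_p(q)/p`
(`Maynard2016Lemma7SingFactor`):
* `classCount_pos_of_even` (`m` even), `not_dvd_of_mem_midPrimes_of_prime` (a prime `q > y` has no
  prime factor in `(w, y]`), `not_dvd_hTuple_sub_of_mem_midPrimes` (for large `x` no prime in `(w, y]`
  divides an `h_j − h_i`, `i ≠ j`);
* `inv_normMain_eq` — `M_{m,q}⁻¹ = K_m · R_q · V_q⁻¹` with the `q`-INDEPENDENT factor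
  `K_m = m (log x)^k (log y)^k P_w / (U · classCount · singSmall · I1 · I2 · Π_m)`;
* `inv_normMain_ge` — **`M_{m,q}⁻¹ ≥ K_m (2 − e^{24k²/(w+1)}) (1 − Σ_{w<p≤y, p∤m} #M_p(q)/p)`**
  (once `e^{24k²/(w+1)} ≤ 2`), the `q`-uniform lower bound through which the `q`-sum of Lemma 7
  absorbs the `q`-dependence of the normalisation;
* `sum_mul_sum_card_couplingSet_div_eq`, `sum_div_normMain_ge` — summed over a set `Q` of primes
  `> y` against `T ≥ 0`: **`Σ_{q∈Q} T(q)/M_{m,q} ≥ K_m (2 − e^{24k²/(w+1)}) (Σ_{q∈Q} T(q) −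
  Σ_{(a,b)} Σ_{w<p≤y, p∤m} p⁻¹ Σ_{q∈Q : p ∣ m q(h_b−h_a)−1} T(q))`** — the correction is a sum of
  the SAME `q`-sums with one extra congruence condition on `q` each;
* `eventually_y_lt_half_of_nonneg`, `eventually_normSideConditions`, `eventually_sum_div_normMain_ge` — the
  same for ALL LARGE `x`, every even `m`, every set `Q` of primes `≥ x/2` and every `T ≥ 0` (all
  side conditions discharged: `w → ∞`, `⌊w⌋ ≤ ⌊y⌋`, the prime factors of `h_j − h_i` divide `P_w`,
  `y < x/2`).

## References

* J. Maynard, *Large gaps between primes*, Ann. of Math. (2) 183 (2016), 915–933; arXiv:1408.5110,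
  §6, proof of Lemma 7, displays (6.23)–(6.25). [Maynard2016LargeGaps]
-/

noncomputable section

open Finset Filter
open scoped BigOperators

namespace Literature.NumberTheory.Sieve

namespace Maynard2016

variable {k : ℕ}

/-! ### Positivity and the hypotheses on `q` and the `h_j − h_i` -/

/-- `classCount x m > 0` for even `m` (the factor at `p = 2` is `2 − 1`, the others `p − c ≥ p − 2 ≥ 1`).
[cite: Maynard2016LargeGaps, §6 display (6.17)] -/
theorem classCount_pos_of_even {x m : ℕ} (hm : Even m) : 0 < classCount x m := by
  unfold classCount
  refine Finset.prod_pos fun p hp => ?_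
  have hp' : p.Prime := (Finset.mem_filter.1 hp).2
  by_cases h2 : p = 2
  · subst h2
    have hdvd : 2 ∣ m := even_iff_two_dvd.1 hm
    rw [if_pos hdvd]; norm_num
  · have h3 : 3 ≤ p := by
      have := hp'.two_le
      omega
    have h3' : (3 : ℝ) ≤ p := by exact_mod_cast h3
    split_ifs <;> push_cast <;> linarith

/-- A prime `q > y` has no prime factor in `(w, y]`. [cite: Maynard2016LargeGaps, Lemma 7 (proof, display (6.24))] -/
theorem not_dvd_of_mem_midPrimes_of_prime {ε : ℝ} {x q : ℕ} (hq : q.Prime) (hyq : y ε x < q) :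
    ∀ p ∈ midPrimes ε x, ¬ p ∣ q := by
  intro p hp hpq
  simp only [midPrimes, Finset.mem_filter, Finset.mem_Ioc] at hp
  have hpeq : p = q := (Nat.prime_dvd_prime_iff_eq hp.2 hq).1 hpq
  have hy0 : 0 ≤ y ε x := (Real.exp_pos _).le
  have h1 : (p : ℝ) ≤ y ε x := by
    have := Nat.floor_le hy0
    exact le_trans (by exact_mod_cast hp.1.2) this
  rw [hpeq] at h1
  linarith

/-- For large `x` (every prime factor of `h_j − h_i`, `i ≠ j`, divides `P_w`): no prime in `(w, y]`
divides an `h_j − h_i`. [cite: Maynard2016LargeGaps, Lemma 7 (proof, display (6.24))] -/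
theorem not_dvd_hTuple_sub_of_mem_midPrimes {ε : ℝ} {x : ℕ}
    (hW : ∀ a b : Fin k, a ≠ b → ∀ p : ℕ, p.Prime →
      (p : ℤ) ∣ (hTuple k x b : ℤ) - hTuple k x a → p ∣ Pw x) :
    ∀ p ∈ midPrimes ε x, ∀ i j : Fin k, i ≠ j → ¬ (p : ℤ) ∣ (hTuple k x j : ℤ) - hTuple k x i := by
  intro p hp i j hij hdvd
  simp only [midPrimes, Finset.mem_filter, Finset.mem_Ioc] at hp
  have h1 : p ∣ Pw x := hW i j hij p hp.2 hdvd
  unfold Pw at h1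
  have h2 : p ≤ ⌊wFun x⌋₊ := hp.2.dvd_primorial_iff.1 h1
  omega

/-! ### `M_{m,q}⁻¹ = K_m R_q V_q⁻¹` -/

/-- **`M_{m,q}⁻¹ = K_m · R_q · V_q⁻¹`** with `K_m = m (log x)^k (log y)^k P_w/(U classCount singSmall I1 I2 Π_m)`
independent of `q` and `|R_q − 1| ≤ e^{24k²/(w+1)} − 1`. [cite: Maynard2016LargeGaps, Lemma 7 (proof, displays (6.23)–(6.24))] -/
theorem inv_normMain_eq {J : ℕ} (cj : Fin J → ℝ) (Fd : Fin k → Fin J → ℝ → ℝ) (G : ℝ → ℝ)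
    (C_U ε : ℝ) {x m q : ℕ} (hk0 : 0 < k) (hwy : ⌊wFun x⌋₊ ≤ ⌊y ε x⌋₊)
    (hk : 4 * k ≤ ⌊wFun x⌋₊ + 1) (hk' : 2 * k ≤ ⌊wFun x⌋₊) (hpq : ∀ p ∈ midPrimes ε x, ¬ p ∣ q)
    (hdist : ∀ p ∈ midPrimes ε x, ∀ i j : Fin k, i ≠ j →
      ¬ (p : ℤ) ∣ (hTuple k x j : ℤ) - hTuple k x i)
    (hcc : 0 < classCount x m) :
    ∃ R : ℝ, |R - 1| ≤ Real.exp (24 * (k : ℝ) ^ 2 / (⌊wFun x⌋₊ + 1)) - 1 ∧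
      (normMain cj Fd G C_U ε x m q)⁻¹ =
        (m : ℝ) * ((Real.log x) ^ k * (Real.log (y ε x)) ^ k) * Pw x /
            (U C_U ε x * classCount x m * singSmall k x * I1 cj Fd * I2 k G * mPart k ε x m) *
          (R * (vPart k ε x m q)⁻¹) := by
  obtain ⟨R, hRb, hR⟩ := exists_inv_singLarge_eq (m := m) (ε := ε) hk hk' hpq hdist
  refine ⟨R, hRb, ?_⟩
  have hsL : 0 < singLarge k ε x m q := singLarge_pos hk' ε m q
  have hsS : 0 < singSmall k x := singSmall_pos k x
  have hPw : (0 : ℝ) < Pw x := by exact_mod_cast primorial_pos _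
  have hmP : 0 < mPart k ε x m := mPart_pos k ε x m
  have hvP : 0 < vPart k ε x m q := vPart_pos k ε x m q
  have h1 : (normMain cj Fd G C_U ε x m q)⁻¹ =
      (m : ℝ) * ((Real.log x) ^ k * (Real.log (y ε x)) ^ k) * Pw x /
          (U C_U ε x * classCount x m * singSmall k x * I1 cj Fd * I2 k G) *
        (singLarge k ε x m q)⁻¹ := by
    rw [normMain, singSeriesMQ_eq_classCount_mul hk0 ε x m q hwy, inv_div]
    field_simp
  rw [h1, hR]
  field_simp

/-! ### The `q`-uniform lower bound -/

/-- **`M_{m,q}⁻¹ ≥ K_m (2 − e^{24k²/(w+1)}) (1 − Σ_{w<p≤y, p∤m} #M_p(q)/p)`** once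
`e^{24k²/(w+1)} ≤ 2` (and `U, I1, I2, classCount > 0`). [cite: Maynard2016LargeGaps, Lemma 7 (proof, displays (6.23)–(6.25))] -/
theorem inv_normMain_ge {J : ℕ} (cj : Fin J → ℝ) (Fd : Fin k → Fin J → ℝ → ℝ) (G : ℝ → ℝ)
    (C_U ε : ℝ) {x m q : ℕ} (hk0 : 0 < k) (hwy : ⌊wFun x⌋₊ ≤ ⌊y ε x⌋₊)
    (hk : 4 * k ≤ ⌊wFun x⌋₊ + 1) (hk' : 2 * k ≤ ⌊wFun x⌋₊) (hpq : ∀ p ∈ midPrimes ε x, ¬ p ∣ q)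
    (hdist : ∀ p ∈ midPrimes ε x, ∀ i j : Fin k, i ≠ j →
      ¬ (p : ℤ) ∣ (hTuple k x j : ℤ) - hTuple k x i)
    (hη : Real.exp (24 * (k : ℝ) ^ 2 / (⌊wFun x⌋₊ + 1)) ≤ 2) (hU : 0 < U C_U ε x)
    (hI1 : 0 < I1 cj Fd) (hI2 : 0 < I2 k G) (hcc : 0 < classCount x m)
    (hL : 0 ≤ (Real.log x) ^ k * (Real.log (y ε x)) ^ k) :
    (m : ℝ) * ((Real.log x) ^ k * (Real.log (y ε x)) ^ k) * Pw x /
          (U C_U ε x * classCount x m * singSmall k x * I1 cj Fd * I2 k G * mPart k ε x m) *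
        ((2 - Real.exp (24 * (k : ℝ) ^ 2 / (⌊wFun x⌋₊ + 1))) *
          (1 - ∑ p ∈ (midPrimes ε x).filter (fun p => ¬ p ∣ m),
            ((couplingSet k x m q p).card : ℝ) / p)) ≤
      (normMain cj Fd G C_U ε x m q)⁻¹ := by
  obtain ⟨R, hRb, hR⟩ := inv_normMain_eq cj Fd G C_U ε hk0 hwy hk hk' hpq hdist hcc
  rw [hR]
  have hsS : 0 < singSmall k x := singSmall_pos k x
  have hPw : (0 : ℝ) < Pw x := by exact_mod_cast primorial_pos _
  have hmP : 0 < mPart k ε x m := mPart_pos k ε x m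
  have hvP : 0 < vPart k ε x m q := vPart_pos k ε x m q
  have hK : 0 ≤ (m : ℝ) * ((Real.log x) ^ k * (Real.log (y ε x)) ^ k) * Pw x /
      (U C_U ε x * classCount x m * singSmall k x * I1 cj Fd * I2 k G * mPart k ε x m) :=
    div_nonneg (mul_nonneg (mul_nonneg (Nat.cast_nonneg _) hL) hPw.le) (by positivity)
  refine mul_le_mul_of_nonneg_left ?_ hK
  -- `(2 − e)(1 − Σ) ≤ R · V⁻¹`
  have hR1 : 2 - Real.exp (24 * (k : ℝ) ^ 2 / (⌊wFun x⌋₊ + 1)) ≤ R := by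
    have := (abs_le.1 hRb).1
    linarith
  have hR0 : 0 ≤ 2 - Real.exp (24 * (k : ℝ) ^ 2 / (⌊wFun x⌋₊ + 1)) := by linarith
  have hV := one_sub_sum_le_inv_vPart k ε x m q
  have hVpos : 0 < (vPart k ε x m q)⁻¹ := inv_pos.2 hvP
  by_cases hS0 : 1 - ∑ p ∈ (midPrimes ε x).filter (fun p => ¬ p ∣ m),
      ((couplingSet k x m q p).card : ℝ) / p ≤ 0
  · exact le_trans (mul_nonpos_of_nonneg_of_nonpos hR0 hS0)
      (mul_nonneg (hR0.trans hR1) hVpos.le)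
  · push Not at hS0
    exact mul_le_mul hR1 hV hS0.le (hR0.trans hR1)

/-! ### Summing over `q`: the first-order correction as single congruence conditions -/

/-- Interchanging the `q`-sum with the union bound:
`Σ_q T(q) Σ_{p∈S} #M_p(q)/p = Σ_{(a,b)} Σ_{p∈S} p⁻¹ Σ_{q : p ∣ m q (h_b − h_a) − 1} T(q)`.
[cite: Maynard2016LargeGaps, Lemma 7 (proof, display (6.25))] -/
theorem sum_mul_sum_card_couplingSet_div_eq (k x m : ℕ) (S Q : Finset ℕ) (T : ℕ → ℝ) :
    ∑ q ∈ Q, T q * ∑ p ∈ S, ((couplingSet k x m q p).card : ℝ) / p =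
      ∑ ij : Fin k × Fin k, ∑ p ∈ S, (1 : ℝ) / p *
        ∑ q ∈ Q.filter (fun q : ℕ =>
          (p : ℤ) ∣ (m : ℤ) * q * ((hTuple k x ij.2 : ℤ) - hTuple k x ij.1) - 1), T q := by
  classical
  have h1 : ∀ q ∈ Q, T q * ∑ p ∈ S, ((couplingSet k x m q p).card : ℝ) / p =
      ∑ ij : Fin k × Fin k, ∑ p ∈ S,
        if (p : ℤ) ∣ (m : ℤ) * q * ((hTuple k x ij.2 : ℤ) - hTuple k x ij.1) - 1
          then (1 : ℝ) / p * T q else 0 := by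
    intro q _
    rw [sum_card_couplingSet_div_eq, Finset.mul_sum]
    refine Finset.sum_congr rfl fun ij _ => ?_
    rw [Finset.sum_filter, Finset.mul_sum]
    refine Finset.sum_congr rfl fun p _ => ?_
    split_ifs <;> ring
  rw [Finset.sum_congr rfl h1, Finset.sum_comm]
  refine Finset.sum_congr rfl fun ij _ => ?_
  rw [Finset.sum_comm]
  refine Finset.sum_congr rfl fun p _ => ?_
  rw [Finset.sum_filter, Finset.mul_sum]
  refine Finset.sum_congr rfl fun q _ => ?_
  split_ifs <;> ring

/-- **The `q`-sum against `M_{m,q}⁻¹`, first order ((6.23)–(6.25) summed over `q`):** for `T ≥ 0`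
and a set `Q` of primes `> y`,
`Σ_{q∈Q} T(q)/M_{m,q} ≥ K_m (2 − e^{24k²/(w+1)}) (Σ_{q∈Q} T(q) − Σ_{(a,b)} Σ_{w<p≤y, p∤m} p⁻¹ Σ_{q∈Q : p ∣ m q(h_b−h_a)−1} T(q))`.
[cite: Maynard2016LargeGaps, Lemma 7 (proof, displays (6.23)–(6.25))] -/
theorem sum_div_normMain_ge {J : ℕ} (cj : Fin J → ℝ) (Fd : Fin k → Fin J → ℝ → ℝ) (G : ℝ → ℝ)
    (C_U ε : ℝ) {x m : ℕ} (hk0 : 0 < k) (hwy : ⌊wFun x⌋₊ ≤ ⌊y ε x⌋₊)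
    (hk : 4 * k ≤ ⌊wFun x⌋₊ + 1) (hk' : 2 * k ≤ ⌊wFun x⌋₊)
    (hdist : ∀ p ∈ midPrimes ε x, ∀ i j : Fin k, i ≠ j →
      ¬ (p : ℤ) ∣ (hTuple k x j : ℤ) - hTuple k x i)
    (hη : Real.exp (24 * (k : ℝ) ^ 2 / (⌊wFun x⌋₊ + 1)) ≤ 2) (hU : 0 < U C_U ε x)
    (hI1 : 0 < I1 cj Fd) (hI2 : 0 < I2 k G) (hcc : 0 < classCount x m)
    (hL : 0 ≤ (Real.log x) ^ k * (Real.log (y ε x)) ^ k) (Q : Finset ℕ)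
    (hQ : ∀ q ∈ Q, q.Prime ∧ y ε x < q) (T : ℕ → ℝ) (hT : ∀ q, 0 ≤ T q) :
    (m : ℝ) * ((Real.log x) ^ k * (Real.log (y ε x)) ^ k) * Pw x /
          (U C_U ε x * classCount x m * singSmall k x * I1 cj Fd * I2 k G * mPart k ε x m) *
        ((2 - Real.exp (24 * (k : ℝ) ^ 2 / (⌊wFun x⌋₊ + 1))) *
          (∑ q ∈ Q, T q -
            ∑ ij : Fin k × Fin k, ∑ p ∈ (midPrimes ε x).filter (fun p => ¬ p ∣ m), (1 : ℝ) / p *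
              ∑ q ∈ Q.filter (fun q : ℕ =>
                (p : ℤ) ∣ (m : ℤ) * q * ((hTuple k x ij.2 : ℤ) - hTuple k x ij.1) - 1), T q)) ≤
      ∑ q ∈ Q, T q / normMain cj Fd G C_U ε x m q := by
  set K := (m : ℝ) * ((Real.log x) ^ k * (Real.log (y ε x)) ^ k) * Pw x /
      (U C_U ε x * classCount x m * singSmall k x * I1 cj Fd * I2 k G * mPart k ε x m) with hK
  set η := 2 - Real.exp (24 * (k : ℝ) ^ 2 / (⌊wFun x⌋₊ + 1)) with hη'
  rw [← sum_mul_sum_card_couplingSet_div_eq, ← Finset.sum_sub_distrib, Finset.mul_sum,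
    Finset.mul_sum]
  refine Finset.sum_le_sum fun q hq => ?_
  have h1 := inv_normMain_ge cj Fd G C_U ε (m := m) hk0 hwy hk hk'
    (not_dvd_of_mem_midPrimes_of_prime (hQ q hq).1 (hQ q hq).2) hdist hη hU hI1 hI2 hcc hL
  rw [div_eq_mul_inv]
  have h2 := mul_le_mul_of_nonneg_left h1 (hT q)
  calc K * (η * (T q - T q * ∑ p ∈ (midPrimes ε x).filter (fun p => ¬ p ∣ m),
          ((couplingSet k x m q p).card : ℝ) / p))
        = T q * (K * (η * (1 - ∑ p ∈ (midPrimes ε x).filter (fun p => ¬ p ∣ m),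
            ((couplingSet k x m q p).card : ℝ) / p))) := by ring
    _ ≤ T q * (normMain cj Fd G C_U ε x m q)⁻¹ := h2

/-! ### Everything eventually: the side conditions for large `x` -/

/-- For `0 ≤ ε` and large `x`: `y < x/2` (`log y ≤ log x − 1`; the variant of
`NuProd.eventually_y_lt_half` allowing `ε = 0`). [cite: Maynard2016LargeGaps, §2 display (2.1)] -/
theorem eventually_y_lt_half_of_nonneg {ε : ℝ} (hε0 : 0 ≤ ε) :
    ∀ᶠ x : ℕ in atTop, y ε x < (x : ℝ) / 2 := by
  filter_upwards [eventually_iteratedLogs, eventually_ge_atTop 1] with x hx hx1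
  obtain ⟨hL, hL₂, hL₃, hL₃₂, hL₂L, -, -⟩ := hx
  have hx0 : (0 : ℝ) < x := by exact_mod_cast hx1
  set L := Real.log x with hLdef
  set L₂ := Real.log (Real.log x) with hL₂def
  set L₃ := Real.log (Real.log (Real.log x)) with hL₃def
  have hL₂pos : 0 < L₂ := by linarith
  have h2 : L * L₃ / L₂ ≤ L - 1 := by
    rw [div_le_iff₀ hL₂pos]
    nlinarith
  have h3 : 0 ≤ L * L₃ / L₂ := by positivity
  have h1 : Real.log (y ε x) ≤ L - 1 := by
    rw [log_y]
    exact (mul_le_of_le_one_left h3 (by linarith)).trans h2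
  have hy : y ε x = Real.exp (Real.log (y ε x)) :=
    (Real.exp_log (show 0 < y ε x from Real.exp_pos _)).symm
  have h4 : y ε x ≤ (x : ℝ) / Real.exp 1 := by
    rw [hy, div_eq_mul_inv, ← Real.exp_neg, ← Real.exp_log hx0, ← Real.exp_add]
    exact Real.exp_le_exp.2 (by rw [hLdef] at h1; linarith)
  have h5 : (x : ℝ) / Real.exp 1 < x / 2 :=
    div_lt_div_of_pos_left hx0 (by norm_num) (by linarith [Real.exp_one_gt_d9])
  linarith

/-- The side conditions of `sum_div_normMain_ge` hold for all large `x` (`0 ≤ ε ≤ 1/2`).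
[cite: Maynard2016LargeGaps, Lemma 7 (proof, displays (6.23)–(6.25))] -/
theorem eventually_normSideConditions (k : ℕ) {ε : ℝ} (hε0 : 0 ≤ ε) (hε : ε ≤ 1 / 2) :
    ∀ᶠ x : ℕ in atTop, 4 * k ≤ ⌊wFun x⌋₊ + 1 ∧ 2 * k ≤ ⌊wFun x⌋₊ ∧
      Real.exp (24 * (k : ℝ) ^ 2 / (⌊wFun x⌋₊ + 1)) ≤ 2 ∧ ⌊wFun x⌋₊ ≤ ⌊y ε x⌋₊ ∧
      (∀ p ∈ midPrimes ε x, ∀ i j : Fin k, i ≠ j →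
        ¬ (p : ℤ) ∣ (hTuple k x j : ℤ) - hTuple k x i) ∧
      y ε x < (x : ℝ) / 2 ∧ 0 ≤ (Real.log x) ^ k * (Real.log (y ε x)) ^ k := by
  filter_upwards [eventually_le_wFun ((4 * k + 48 * k ^ 2 : ℕ) : ℝ),
    eventually_floor_wFun_le_floor_y hε, eventually_prime_dvd_Pw_of_dvd_hTuple_sub k,
    eventually_y_lt_half_of_nonneg hε0, eventually_iteratedLogs] with x hw hwy hPw hyx hlogs
  obtain ⟨hL, hL₂, hL₃, hL₃₂, hL₂L, -, -⟩ := hlogs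
  have hfl : 4 * k + 48 * k ^ 2 ≤ ⌊wFun x⌋₊ := Nat.le_floor hw
  have hlogy : 0 < Real.log (y ε x) := log_y_pos hε (by linarith) (by linarith) hL₃
  refine ⟨by omega, by nlinarith, ?_, hwy, not_dvd_hTuple_sub_of_mem_midPrimes hPw, hyx,
    by positivity⟩
  have hW : (48 * (k : ℝ) ^ 2 : ℝ) ≤ ⌊wFun x⌋₊ := by
    have : ((4 * k + 48 * k ^ 2 : ℕ) : ℝ) ≤ ⌊wFun x⌋₊ := by exact_mod_cast hfl
    push_cast at this
    nlinarith
  have h1 : 24 * (k : ℝ) ^ 2 / (⌊wFun x⌋₊ + 1) ≤ Real.log 2 := by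
    rw [div_le_iff₀ (by positivity)]
    nlinarith [Real.log_two_gt_d9]
  calc Real.exp (24 * (k : ℝ) ^ 2 / (⌊wFun x⌋₊ + 1)) ≤ Real.exp (Real.log 2) :=
        Real.exp_le_exp.2 h1
    _ = 2 := Real.exp_log (by norm_num)

/-- **(6.23)–(6.25) summed over `q`, eventually:** for `0 ≤ ε ≤ 1/2`, `k ≥ 1` and all large `x`:
for every even `m` (with `U, I1, I2 > 0`), every set `Q` of primes `≥ x/2` and every `T ≥ 0`,
`Σ_{q∈Q} T(q)/M_{m,q} ≥ K_m (2 − e^{24k²/(w+1)}) (Σ_{q∈Q} T(q) − Σ_{(a,b)} Σ_{w<p≤y, p∤m} p⁻¹ Σ_{q∈Q : p ∣ m q(h_b−h_a)−1} T(q))`.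
[cite: Maynard2016LargeGaps, Lemma 7 (proof, displays (6.23)–(6.25))] -/
theorem eventually_sum_div_normMain_ge {J : ℕ} (cj : Fin J → ℝ) (Fd : Fin k → Fin J → ℝ → ℝ)
    (G : ℝ → ℝ) (C_U : ℝ) {ε : ℝ} (hε0 : 0 ≤ ε) (hε : ε ≤ 1 / 2) (hk0 : 0 < k) :
    ∀ᶠ x : ℕ in atTop, ∀ m : ℕ, Even m → 0 < U C_U ε x → 0 < I1 cj Fd → 0 < I2 k G →
      ∀ Q : Finset ℕ, (∀ q ∈ Q, q.Prime ∧ (x : ℝ) / 2 ≤ q) → ∀ T : ℕ → ℝ, (∀ q, 0 ≤ T q) →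
        (m : ℝ) * ((Real.log x) ^ k * (Real.log (y ε x)) ^ k) * Pw x /
              (U C_U ε x * classCount x m * singSmall k x * I1 cj Fd * I2 k G * mPart k ε x m) *
            ((2 - Real.exp (24 * (k : ℝ) ^ 2 / (⌊wFun x⌋₊ + 1))) *
              (∑ q ∈ Q, T q -
                ∑ ij : Fin k × Fin k, ∑ p ∈ (midPrimes ε x).filter (fun p => ¬ p ∣ m),
                  (1 : ℝ) / p *
                    ∑ q ∈ Q.filter (fun q : ℕ =>
                      (p : ℤ) ∣ (m : ℤ) * q * ((hTuple k x ij.2 : ℤ) - hTuple k x ij.1) - 1),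
                      T q)) ≤
          ∑ q ∈ Q, T q / normMain cj Fd G C_U ε x m q := by
  filter_upwards [eventually_normSideConditions k hε0 hε] with x hx m hm hU hI1 hI2 Q hQ T hT
  obtain ⟨hk, hk', hη, hwy, hdist, hyx, hL⟩ := hx
  exact sum_div_normMain_ge cj Fd G C_U ε hk0 hwy hk hk' hdist hη hU hI1 hI2
    (classCount_pos_of_even hm) hL Q (fun q hq => ⟨(hQ q hq).1, by linarith [(hQ q hq).2]⟩) T hT

end Maynard2016

end Literature.NumberTheory.Sieve

end
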